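import Summits.MatrixMultiplication.MatrixMultiplication.Theorems.ObstructionDescentUniversalOccurrenceHypersurfaceEquation
import Summits.MatrixMultiplication.MatrixMultiplication.Theorems.ObstructionDescentSlotCharacterDescent
import Literature.Computability.AlgebraicComplexity.ApolarityFischerPairing

set_option linter.dupNamespace false
set_option autoImplicit false

/-!
# The equation of a `GL³`-stable irreducible hypersurface is an `SL³`-invariant form (decomp-mm · lens 3 · gen 41)

Support for the crux `NoOccurrenceObstruction` of `route-MatrixMultiplication-ObstructionDescent` through the
universal-occurrence ladder `u(N)`; nothing here enters `closes`.

`uocc_eighteen_seven_of_equation` (gen 40, `…HypersurfaceEquation`) concludes `UOCC(18,7)` from an irreducible form `F` on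
`ℂ⁷⊗ℂ⁷⊗ℂ⁷` whose zeros have border rank `≤ 18`, PROVIDED `F` is homogeneous of a degree `7δ` and `SL₇³`-invariant.  This file
removes the proviso: it is a CONSEQUENCE of `Z(F) = {algBorderRank ≤ 18}` (indeed of `Z(F)` being any `GL₇³`-stable set).

* §1 `exists_evalT_actTensor_eq_mul_of_irreducible` — if `F` is irreducible and its zero set `Z(F) = S` is stable under every
  invertible `(A,B,C)`, then `F` is `GL_N³`-SEMI-INVARIANT: `F((A,B,C)·t) = c·F(t)` with `c = c(A,B,C) ≠ 0`
  (Nullstellensatz: `F ∣ (A,B,C)·F`; composing with the inverse triple shows the cofactor is a unit of `ℂ[x]`, i.e. a scalar).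
* §2 `exists_character_of_slot_semiInvariant` — a polynomial semi-invariant under a one-slot action `ρ` of `GL_N` has character
  `det^δ`: the character is `1` on transvections (`a ↦ F(ρ(1 + aE_{ij})t₀)` is a nowhere-vanishing polynomial in `a`, hence
  constant), it is the monomial `∏ D_a^{w_a(μ)}` on `diag D` for every monomial `μ` of `F` (coefficient comparison,
  `coeff_linSubst_diagonal`), the slot weights `w_a(μ)` do not depend on `a` (conjugation by the transposition matrices) nor on
  `μ`; conclude by Mathlib's `diagonal_transvection_induction_of_det_ne_zero`.
* §3 `exists_mem_sl3InvariantsOfDegree_of_semiInvariant` — hence a `GL_N³`-semi-invariant `F ≠ 0` lies in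
  `O(⊗³ℂ^N)^{SL³}_{Nδ}` for one `δ`, with character `(det A · det B · det C)^δ`; §4 the corollaries
  `uocc_of_irreducible_equation` (general `(r; N³)`) and **`uocc_eighteen_seven_of_irreducible_equation`**:
  UOCC(18,7) ⟸ { ∃ irreducible `F` with `F(t) = 0 ↔ algBorderRank t ≤ 18` } + { `k_7(6) ≥ 2 ∧ k_7(7) ≥ 2` }.
The remaining dictionary at `(18; 7,7,7)` is thus exactly "`σ₁₈(ℂ⁷⊗ℂ⁷⊗ℂ⁷)` is the zero set of ONE irreducible polynomial"
(an irreducible hypersurface: `dim = 342 = 343 − 1` [cite: BurgisserClausenShokrollahi1997, Thm. 20.3, Lemma 20.10]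
[cite: Lickteig1985]) and the two Kronecker atoms [cite: BurgisserIkenmeyer2017, §5].

All statements are `theorem`s; no `def`, no `sorry`.
-/

open scoped BigOperators

namespace Summit.MatrixMultiplication.MatrixMultiplication.Theorems.ObstructionCalculus

open Literature.Computability.AlgebraicComplexity (kroneckerPow isotypicSum₁ isotypicSum₂ isotypicSum₃ unitTensor algBorderRank
  sl3InvariantsOfDegree mem_sl3InvariantsOfDegree_iff kronRect IsSL3Invariant linSubst coeff_linSubst_diagonal actTensor
  actTensor_actTensor actTensor_one actTensor_add_fst actTensor_smul_fst actTensor_add_snd actTensor_smul_snd actTensor_add_thd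
  actTensor_smul_thd)
open Summit.MatrixMultiplication.MatrixMultiplication.Theorems.ObstructionDescentTorusLaws (actTensor_torus)
open Summit.MatrixMultiplication.MatrixMultiplication.Theorems.ObstructionDescentDominance (evalT_X)

variable {N : ℕ}

/-! ## §0 Evaluation bookkeeping -/

/-- `evalT` of a constant. [bookkeeping] -/
theorem evalT_C (t : Tensor ℂ N) (c : ℂ) : evalT t (MvPolynomial.C c) = c :=
  (evalT t).commutes c

/-- A diagonal substitution `x_p ↦ β_p x_p` is evaluated by rescaling the entries of the tensor. [bookkeeping] -/
theorem evalT_linSubst_diagonal (β : Idx N → ℂ) (f : MvPolynomial (Idx N) ℂ) (t : Tensor ℂ N) :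
    evalT t (linSubst (Idx N) ℂ (Matrix.diagonal β) f) = evalT (fun a b c => β (a, b, c) * t a b c) f := by
  classical
  have h1 : evalT t (linSubst (Idx N) ℂ (Matrix.diagonal β) f) = ((evalT t).comp (MvPolynomial.aeval fun i : Idx N =>
      ∑ j : Idx N, Matrix.diagonal β j i • (MvPolynomial.X j : MvPolynomial (Idx N) ℂ))) f := rfl
  have hfun : (fun i : Idx N => evalT t (∑ j : Idx N, Matrix.diagonal β j i • (MvPolynomial.X j : MvPolynomial (Idx N) ℂ))) =
      fun p : Idx N => β p * t p.1 p.2.1 p.2.2 := by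
    funext i
    rw [map_sum, Finset.sum_eq_single i (fun j _ hj => by rw [Matrix.diagonal_apply_ne _ hj, zero_smul, map_zero])
      (fun h => absurd (Finset.mem_univ i) h), Matrix.diagonal_apply_eq, map_smul, smul_eq_mul, evalT_X]
  rw [h1, MvPolynomial.comp_aeval, hfun]
  rfl

/-- Restriction of a polynomial function to the affine line `a ↦ t₀ + a·t₁` of tensors is a polynomial in `a`. [folklore] -/
theorem eval_aeval_line (t₀ t₁ : Tensor ℂ N) (f : MvPolynomial (Idx N) ℂ) (a : ℂ) :
    (MvPolynomial.aeval (fun p : Idx N => Polynomial.C (t₀ p.1 p.2.1 p.2.2) +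
        Polynomial.X * Polynomial.C (t₁ p.1 p.2.1 p.2.2)) f).eval a = evalT (t₀ + a • t₁) f := by
  have hfun : (fun p : Idx N => Polynomial.aeval a (Polynomial.C (t₀ p.1 p.2.1 p.2.2) +
      Polynomial.X * Polynomial.C (t₁ p.1 p.2.1 p.2.2))) = fun p : Idx N => (t₀ + a • t₁) p.1 p.2.1 p.2.2 := by
    funext p
    simp only [Polynomial.coe_aeval_eq_eval, Polynomial.eval_add, Polynomial.eval_C, Polynomial.eval_mul,
      Polynomial.eval_X, Pi.add_apply, Pi.smul_apply, smul_eq_mul]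
  rw [← Polynomial.coe_aeval_eq_eval, ← AlgHom.comp_apply, MvPolynomial.comp_aeval, hfun]
  rfl

/-- A polynomial in one complex variable without zeros is constant. [folklore] -/
theorem polynomial_eval_eq_eval_zero_of_forall_ne_zero {Q : Polynomial ℂ} (h : ∀ a : ℂ, Q.eval a ≠ 0) (a : ℂ) :
    Q.eval a = Q.eval 0 := by
  have hdeg : Q.degree ≤ 0 := by
    by_contra hlt
    obtain ⟨z, hz⟩ := Complex.exists_root (not_le.1 hlt)
    exact h z hz
  rw [Polynomial.eq_C_of_degree_le_zero hdeg, Polynomial.eval_C, Polynomial.eval_C]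

/-! ## §1 Semi-invariance of the equation of a stable irreducible hypersurface -/

/-- **Semi-invariance.**  Let `F` be irreducible with zero set `Z(F) = S` stable under every invertible triple
`(A,B,C) ∈ GL_N³`.  Then `F((A,B,C)·t) = c·F(t)` for all `t`, with a constant `c = c(A,B,C) ≠ 0`: by the Nullstellensatz
`F ∣ (A,B,C)·F` and `F ∣ (A,B,C)⁻¹·F`, and composing the two substitutions is the identity, so the cofactor is a unit of
`ℂ[x]`, a non-zero scalar. [folklore] [cite: Grosshans1997, §11, proof of Thm. 11.2 and Ex. 2 (irreducible factors of weight
functions are weight functions)] [cite: BurgisserIkenmeyer2017, §5, Lemma 5.1] -/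
theorem exists_evalT_actTensor_eq_mul_of_irreducible {F : MvPolynomial (Idx N) ℂ} (hirr : Irreducible F)
    {S : Tensor ℂ N → Prop} (hZ : ∀ t : Tensor ℂ N, evalT t F = 0 ↔ S t)
    (hS : ∀ (A B C : Matrix (Fin N) (Fin N) ℂ), A.det ≠ 0 → B.det ≠ 0 → C.det ≠ 0 →
      ∀ t : Tensor ℂ N, S t → S (actTensor A B C t))
    {A B C : Matrix (Fin N) (Fin N) ℂ} (hA : A.det ≠ 0) (hB : B.det ≠ 0) (hC : C.det ≠ 0) :
    ∃ c : ℂ, c ≠ 0 ∧ ∀ t : Tensor ℂ N, evalT (actTensor A B C t) F = c * evalT t F := by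
  classical
  have hdvd : ∀ (A B C : Matrix (Fin N) (Fin N) ℂ), A.det ≠ 0 → B.det ≠ 0 → C.det ≠ 0 →
      F ∣ linSubst (Idx N) ℂ (Matrix.of fun x i : Idx N => A i.1 x.1 * B i.2.1 x.2.1 * C i.2.2 x.2.2) F := by
    intro A B C hA hB hC
    refine dvd_of_forall_aeval_eq_zero_of_irreducible hirr fun x hx => ?_
    rw [← evalT_curry_eq_aeval] at hx ⊢
    rw [evalT_linSubst]
    exact (hZ _).2 (hS A B C hA hB hC _ ((hZ _).1 hx))
  have hA' : IsUnit A.det := isUnit_iff_ne_zero.2 hA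
  have hB' : IsUnit B.det := isUnit_iff_ne_zero.2 hB
  have hC' : IsUnit C.det := isUnit_iff_ne_zero.2 hC
  obtain ⟨q, hq⟩ := hdvd A B C hA hB hC
  obtain ⟨q', hq'⟩ := hdvd A⁻¹ B⁻¹ C⁻¹ (Matrix.isUnit_nonsing_inv_det A hA').ne_zero
    (Matrix.isUnit_nonsing_inv_det B hB').ne_zero (Matrix.isUnit_nonsing_inv_det C hC').ne_zero
  have hcomp : linSubst (Idx N) ℂ (Matrix.of fun x i : Idx N => A i.1 x.1 * B i.2.1 x.2.1 * C i.2.2 x.2.2)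
      (linSubst (Idx N) ℂ (Matrix.of fun x i : Idx N => A⁻¹ i.1 x.1 * B⁻¹ i.2.1 x.2.1 * C⁻¹ i.2.2 x.2.2) F) = F := by
    refine ext_evalT fun t => ?_
    rw [evalT_linSubst, evalT_linSubst, actTensor_actTensor, Matrix.nonsing_inv_mul A hA',
      Matrix.nonsing_inv_mul B hB', Matrix.nonsing_inv_mul C hC', actTensor_one]
  have hunit : IsUnit q := by
    rw [hq', map_mul, hq, mul_assoc] at hcomp
    have h1 : q * _ = 1 := mul_left_cancel₀ hirr.ne_zero (hcomp.trans (mul_one F).symm)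
    exact isUnit_iff_exists.2 ⟨_, h1, (mul_comm _ _).trans h1⟩
  obtain ⟨c, hc, hqc⟩ := MvPolynomial.isUnit_iff_eq_C_of_isReduced.1 hunit
  refine ⟨c, hc.ne_zero, fun t => ?_⟩
  rw [← evalT_linSubst, hq, hqc, map_mul, evalT_C, mul_comm]

/-! ## §2 The character of a one-slot semi-invariant is a power of the determinant -/

/-- **One-slot character.**  Let `ρ` be a one-slot action of `Mat_N` on tensors (multiplicative, unital, linear in the matrix,
with `ρ(diag D)` rescaling the coordinate `x_p` by `D_{s(p)}`), and let `F ≠ 0` satisfy `F(ρ(M)t) = c_M·F(t)` (`c_M ≠ 0`) for every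
invertible `M`.  Then there is `δ` such that every monomial of `F` has slot weight `δ` at every index, and `c_M = det(M)^δ`.
[folklore] [cite: BurgisserIkenmeyer2017, §5, Lemma 5.1 (invariants of degree `m·a(w)·k` are the powers of the character)] -/
theorem exists_character_of_slot_semiInvariant (hN : 0 < N) {F : MvPolynomial (Idx N) ℂ} (hF0 : F ≠ 0)
    (ρ : Matrix (Fin N) (Fin N) ℂ → Tensor ℂ N → Tensor ℂ N) (s : Idx N → Fin N)
    (hmul : ∀ (M M' : Matrix (Fin N) (Fin N) ℂ) (t : Tensor ℂ N), ρ (M * M') t = ρ M (ρ M' t))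
    (hone : ∀ t : Tensor ℂ N, ρ 1 t = t)
    (hadd : ∀ (M M' : Matrix (Fin N) (Fin N) ℂ) (t : Tensor ℂ N), ρ (M + M') t = ρ M t + ρ M' t)
    (hsmul : ∀ (a : ℂ) (M : Matrix (Fin N) (Fin N) ℂ) (t : Tensor ℂ N), ρ (a • M) t = a • ρ M t)
    (hdiag : ∀ (D : Fin N → ℂ) (t : Tensor ℂ N) (a b c : Fin N), ρ (Matrix.diagonal D) t a b c = D (s (a, b, c)) * t a b c)
    (hsemi : ∀ M : Matrix (Fin N) (Fin N) ℂ, M.det ≠ 0 →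
      ∃ c : ℂ, c ≠ 0 ∧ ∀ t : Tensor ℂ N, evalT (ρ M t) F = c * evalT t F) :
    ∃ δ : ℕ, (∀ μ ∈ F.support, ∀ a : Fin N, (∑ p ∈ μ.support with s p = a, μ p) = δ) ∧
      ∀ M : Matrix (Fin N) (Fin N) ℂ, M.det ≠ 0 → ∀ t : Tensor ℂ N, evalT (ρ M t) F = M.det ^ δ * evalT t F := by
  classical
  obtain ⟨w₀, hw₀⟩ := exists_evalT_ne_zero hF0
  obtain ⟨μ₀, hμ₀⟩ : ∃ μ, μ ∈ F.support :=
    (MvPolynomial.ne_zero_iff.1 hF0).imp fun d hd => MvPolynomial.mem_support_iff.2 hd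
  -- (★) on the torus the character is the monomial of every exponent in the support
  have hstar : ∀ (D : Fin N → ℂ) (c : ℂ), (∀ t, evalT (ρ (Matrix.diagonal D) t) F = c * evalT t F) →
      ∀ μ ∈ F.support, (∏ p ∈ μ.support, D (s p) ^ μ p) = c := by
    intro D c hc μ hμ
    have hpoly : linSubst (Idx N) ℂ (Matrix.diagonal fun p : Idx N => D (s p)) F = c • F := by
      refine ext_evalT fun t => ?_
      have hT : (fun a b c' => D (s (a, b, c')) * t a b c') = ρ (Matrix.diagonal D) t := by
        funext a b c'
        exact (hdiag D t a b c').symm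
      rw [evalT_linSubst_diagonal, evalT_smul, ← hc t, hT]
    have hcoeff := congrArg (MvPolynomial.coeff μ) hpoly
    rw [coeff_linSubst_diagonal, MvPolynomial.coeff_smul, smul_eq_mul] at hcoeff
    exact mul_right_cancel₀ (MvPolynomial.mem_support_iff.1 hμ) hcoeff
  -- the diagonal matrices `D⁽ⁱ⁾ = diag(1,…,2,…,1)`: character value `2^{w_i(μ)}` for every `μ` in the support
  have hDi : ∀ i : Fin N, ∃ c : ℂ, c ≠ 0 ∧
      (∀ t, evalT (ρ (Matrix.diagonal fun a : Fin N => if a = i then (2 : ℂ) else 1) t) F = c * evalT t F) ∧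
      ∀ μ ∈ F.support, (2 : ℂ) ^ (∑ p ∈ μ.support with s p = i, μ p) = c := by
    intro i
    obtain ⟨c, hc0, hc⟩ := hsemi (Matrix.diagonal fun a : Fin N => if a = i then (2 : ℂ) else 1) (by
      rw [Matrix.det_diagonal]
      exact Finset.prod_ne_zero_iff.2 fun a _ => by split_ifs <;> norm_num)
    refine ⟨c, hc0, hc, fun μ hμ => ?_⟩
    rw [← hstar _ c hc μ hμ, ← Finset.prod_pow_eq_pow_sum, Finset.prod_filter]
    refine Finset.prod_congr rfl fun p _ => ?_
    split_ifs with h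
    · rfl
    · exact (one_pow _).symm
  -- the slot weight of a monomial does not depend on the index: conjugate `D⁽ⁱ⁾` by the transposition `(i j)`
  have hswap : ∀ (i j : Fin N), ∀ μ ∈ F.support,
      (∑ p ∈ μ.support with s p = i, μ p) = ∑ p ∈ μ.support with s p = j, μ p := by
    intro i j μ hμ
    obtain ⟨ci, -, hci, hωi⟩ := hDi i
    obtain ⟨cj, -, hcj, hωj⟩ := hDi j
    obtain ⟨cP, hcP0, hcP⟩ := hsemi ((Equiv.swap i j).permMatrix ℂ) (by
      rw [Matrix.det_permutation]
      exact Int.cast_ne_zero.2 (Units.ne_zero _))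
    have hconj : (Equiv.swap i j).permMatrix ℂ * Matrix.diagonal (fun a : Fin N => if a = i then (2 : ℂ) else 1) =
        Matrix.diagonal (fun a : Fin N => if a = j then (2 : ℂ) else 1) * (Equiv.swap i j).permMatrix ℂ := by
      ext a b
      simp only [Equiv.Perm.permMatrix, PEquiv.toMatrix_toPEquiv_mul, PEquiv.mul_toMatrix_toPEquiv, Matrix.submatrix_apply,
        id_eq, Matrix.diagonal_apply]
      by_cases hab : (Equiv.swap i j) a = b
      · rw [if_pos hab, if_pos ((Equiv.eq_symm_apply _).2 hab)]
        simp only [Equiv.swap_apply_eq_iff, Equiv.swap_apply_left]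
      · rw [if_neg hab, if_neg (mt (Equiv.eq_symm_apply _).1 hab)]
    have key : cP * ci * evalT w₀ F = cj * cP * evalT w₀ F := by
      have h1 := hmul ((Equiv.swap i j).permMatrix ℂ) (Matrix.diagonal fun a : Fin N => if a = i then (2 : ℂ) else 1) w₀
      have h2 := hmul (Matrix.diagonal fun a : Fin N => if a = j then (2 : ℂ) else 1) ((Equiv.swap i j).permMatrix ℂ) w₀
      have e1 : evalT (ρ ((Equiv.swap i j).permMatrix ℂ * Matrix.diagonal fun a : Fin N => if a = i then (2 : ℂ) else 1) w₀) F =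
          cP * ci * evalT w₀ F := by rw [h1, hcP, hci, mul_assoc]
      have e2 : evalT (ρ (Matrix.diagonal (fun a : Fin N => if a = j then (2 : ℂ) else 1) * (Equiv.swap i j).permMatrix ℂ) w₀) F =
          cj * cP * evalT w₀ F := by rw [h2, hcj, hcP, mul_assoc]
      rw [← e1, ← e2, hconj]
    have hcc : ci = cj := by
      have h := mul_right_cancel₀ hw₀ key
      rw [mul_comm cj cP] at h
      exact mul_left_cancel₀ hcP0 h
    have h2 : (2 : ℂ) ^ (∑ p ∈ μ.support with s p = i, μ p) = (2 : ℂ) ^ (∑ p ∈ μ.support with s p = j, μ p) := by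
      rw [hωi μ hμ, hωj μ hμ, hcc]
    exact Nat.pow_right_injective (le_refl 2) (by exact_mod_cast h2)
  -- … nor on the monomial
  have hconst : ∀ (i : Fin N), ∀ μ ∈ F.support,
      (∑ p ∈ μ.support with s p = i, μ p) = ∑ p ∈ μ₀.support with s p = i, μ₀ p := by
    intro i μ hμ
    obtain ⟨c, -, -, hω⟩ := hDi i
    exact Nat.pow_right_injective (le_refl 2) (by exact_mod_cast (hω μ hμ).trans (hω μ₀ hμ₀).symm)
  refine ⟨∑ p ∈ μ₀.support with s p = ⟨0, hN⟩, μ₀ p, fun μ hμ a => (hconst a μ hμ).trans (hswap a ⟨0, hN⟩ μ₀ hμ₀), ?_⟩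
  have hω : ∀ a : Fin N, (∑ p ∈ μ₀.support with s p = a, μ₀ p) = ∑ p ∈ μ₀.support with s p = ⟨0, hN⟩, μ₀ p :=
    fun a => hswap a ⟨0, hN⟩ μ₀ hμ₀
  -- transvections act trivially: `a ↦ F(ρ(1 + aE_{ij}) w₀)` is a polynomial without zeros
  have htrans : ∀ (i j : Fin N), i ≠ j → ∀ (a : ℂ) (t : Tensor ℂ N), evalT (ρ (Matrix.transvection i j a) t) F = evalT t F := by
    intro i j hij a
    have hρ : ∀ (b : ℂ) (t : Tensor ℂ N), ρ (Matrix.transvection i j b) t = t + b • ρ (Matrix.single i j (1 : ℂ)) t := by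
      intro b t
      rw [Matrix.transvection, show Matrix.single i j b = b • Matrix.single i j (1 : ℂ) by
        rw [Matrix.smul_single, smul_eq_mul, mul_one], hadd, hsmul, hone]
    have hdet : ∀ b : ℂ, (Matrix.transvection i j b).det ≠ 0 := fun b => by
      rw [Matrix.det_transvection_of_ne i j hij]
      exact one_ne_zero
    obtain ⟨c, -, hc⟩ := hsemi _ (hdet a)
    have hQ : ∀ b : ℂ, (MvPolynomial.aeval (fun p : Idx N => Polynomial.C (w₀ p.1 p.2.1 p.2.2) +
        Polynomial.X * Polynomial.C (ρ (Matrix.single i j (1 : ℂ)) w₀ p.1 p.2.1 p.2.2)) F).eval b =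
          evalT (ρ (Matrix.transvection i j b) w₀) F := fun b => by rw [eval_aeval_line, hρ]
    have hne : ∀ b : ℂ, (MvPolynomial.aeval (fun p : Idx N => Polynomial.C (w₀ p.1 p.2.1 p.2.2) +
        Polynomial.X * Polynomial.C (ρ (Matrix.single i j (1 : ℂ)) w₀ p.1 p.2.1 p.2.2)) F).eval b ≠ 0 := by
      intro b
      obtain ⟨c', hc'0, hc'⟩ := hsemi _ (hdet b)
      rw [hQ, hc']
      exact mul_ne_zero hc'0 hw₀
    have hconst' := polynomial_eval_eq_eval_zero_of_forall_ne_zero hne a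
    rw [hQ, hQ, Matrix.transvection_zero, hone, hc] at hconst'
    have hc1 : c = 1 := mul_right_cancel₀ hw₀ (hconst'.trans (one_mul _).symm)
    intro t
    rw [hc t, hc1, one_mul]
  intro M hM
  refine Matrix.diagonal_transvection_induction_of_det_ne_zero
    (fun M => ∀ t : Tensor ℂ N, evalT (ρ M t) F = M.det ^ (∑ p ∈ μ₀.support with s p = ⟨0, hN⟩, μ₀ p) * evalT t F)
    M hM ?_ ?_ ?_
  · intro D hD t
    obtain ⟨c, -, hc⟩ := hsemi _ hD
    rw [hc t, ← hstar D c hc μ₀ hμ₀, Matrix.det_diagonal, ← Finset.prod_pow,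
      ← Finset.prod_fiberwise μ₀.support s (fun p => D (s p) ^ μ₀ p)]
    congr 1
    refine Finset.prod_congr rfl fun a _ => ?_
    rw [← hω a, ← Finset.prod_pow_eq_pow_sum]
    exact Finset.prod_congr rfl fun p hp => by rw [(Finset.mem_filter.1 hp).2]
  · intro τ t
    rw [Matrix.TransvectionStruct.det, one_pow, one_mul]
    exact htrans τ.i τ.j τ.hij τ.c t
  · intro A B _ _ hPA hPB t
    rw [hmul, hPA, hPB, Matrix.det_mul, mul_pow, mul_assoc]

/-! ## §3 `GL_N³`-semi-invariants are `SL_N³`-invariant forms of degree `Nδ` -/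

/-- **Semi-invariant ⟹ invariant form.**  A `GL_N³`-semi-invariant polynomial `F ≠ 0` on `ℂ^N⊗ℂ^N⊗ℂ^N` (`N ≥ 1`) is homogeneous
of degree `Nδ` and `SL_N³`-invariant for one `δ`, and its character is `(det A · det B · det C)^δ`.
[cite: BurgisserIkenmeyer2017, §5, Lemma 5.1] -/
theorem exists_mem_sl3InvariantsOfDegree_of_semiInvariant (hN : 0 < N) {F : MvPolynomial (Idx N) ℂ} (hF0 : F ≠ 0)
    (hsemi : ∀ (A B C : Matrix (Fin N) (Fin N) ℂ), A.det ≠ 0 → B.det ≠ 0 → C.det ≠ 0 →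
      ∃ c : ℂ, c ≠ 0 ∧ ∀ t : Tensor ℂ N, evalT (actTensor A B C t) F = c * evalT t F) :
    ∃ δ : ℕ, F ∈ sl3InvariantsOfDegree (Fin N) ℂ (N * δ) ∧
      ∀ (A B C : Matrix (Fin N) (Fin N) ℂ), A.det ≠ 0 → B.det ≠ 0 → C.det ≠ 0 →
        ∀ t : Tensor ℂ N, evalT (actTensor A B C t) F = (A.det * B.det * C.det) ^ δ * evalT t F := by
  classical
  have h1 : (1 : Matrix (Fin N) (Fin N) ℂ).det ≠ 0 := by
    rw [Matrix.det_one]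
    exact one_ne_zero
  obtain ⟨δ₁, hω₁, hχ₁⟩ := exists_character_of_slot_semiInvariant hN hF0 (fun M t => actTensor M 1 1 t) (fun p => p.1)
    (fun M M' t => by rw [actTensor_actTensor, Matrix.mul_one]) (fun t => actTensor_one t)
    (fun M M' t => actTensor_add_fst M M' 1 1 t) (fun a M t => actTensor_smul_fst a M 1 1 t)
    (fun D t a b c => by rw [← Matrix.diagonal_one, actTensor_torus]; simp only [mul_one])
    (fun M hM => hsemi M 1 1 hM h1 h1)
  obtain ⟨δ₂, hω₂, hχ₂⟩ := exists_character_of_slot_semiInvariant hN hF0 (fun M t => actTensor 1 M 1 t) (fun p => p.2.1)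
    (fun M M' t => by rw [actTensor_actTensor, Matrix.mul_one]) (fun t => actTensor_one t)
    (fun M M' t => actTensor_add_snd 1 M M' 1 t) (fun a M t => actTensor_smul_snd a 1 M 1 t)
    (fun D t a b c => by rw [← Matrix.diagonal_one, actTensor_torus]; simp only [mul_one, one_mul])
    (fun M hM => hsemi 1 M 1 h1 hM h1)
  obtain ⟨δ₃, hω₃, hχ₃⟩ := exists_character_of_slot_semiInvariant hN hF0 (fun M t => actTensor 1 1 M t) (fun p => p.2.2)
    (fun M M' t => by rw [actTensor_actTensor, Matrix.mul_one]) (fun t => actTensor_one t)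
    (fun M M' t => actTensor_add_thd 1 1 M M' t) (fun a M t => actTensor_smul_thd a 1 1 M t)
    (fun D t a b c => by rw [← Matrix.diagonal_one, actTensor_torus]; simp only [mul_one, one_mul])
    (fun M hM => hsemi 1 1 M h1 h1 hM)
  -- the degree of a monomial is `N ·` (its slot weight), in each slot
  have hdeg : ∀ (s : Idx N → Fin N) (δ : ℕ), ∀ μ ∈ F.support, (∀ a : Fin N, (∑ p ∈ μ.support with s p = a, μ p) = δ) →
      (μ : Idx N →₀ ℕ).degree = N * δ := by
    intro s δ μ _ h
    rw [Finsupp.degree_apply, ← Finset.sum_fiberwise μ.support s (fun p => μ p)]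
    simp_rw [h]
    rw [Finset.sum_const, Finset.card_univ, Fintype.card_fin, smul_eq_mul]
  obtain ⟨μ₀, hμ₀⟩ : ∃ μ, μ ∈ F.support :=
    (MvPolynomial.ne_zero_iff.1 hF0).imp fun d hd => MvPolynomial.mem_support_iff.2 hd
  have h21 : δ₂ = δ₁ := Nat.eq_of_mul_eq_mul_left hN
    ((hdeg _ _ μ₀ hμ₀ (hω₂ μ₀ hμ₀)).symm.trans (hdeg _ _ μ₀ hμ₀ (hω₁ μ₀ hμ₀)))
  have h31 : δ₃ = δ₁ := Nat.eq_of_mul_eq_mul_left hN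
    ((hdeg _ _ μ₀ hμ₀ (hω₃ μ₀ hμ₀)).symm.trans (hdeg _ _ μ₀ hμ₀ (hω₁ μ₀ hμ₀)))
  have hsplit : ∀ (A B C : Matrix (Fin N) (Fin N) ℂ) (t : Tensor ℂ N),
      actTensor A B C t = actTensor A (1 : Matrix (Fin N) (Fin N) ℂ) (1 : Matrix (Fin N) (Fin N) ℂ)
        (actTensor (1 : Matrix (Fin N) (Fin N) ℂ) B (1 : Matrix (Fin N) (Fin N) ℂ)
          (actTensor (1 : Matrix (Fin N) (Fin N) ℂ) (1 : Matrix (Fin N) (Fin N) ℂ) C t)) := by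
    intro A B C t
    simp only [actTensor_actTensor, Matrix.mul_one, Matrix.one_mul]
  have hSL : ∀ g : Matrix.SpecialLinearGroup (Fin N) ℂ, (g : Matrix (Fin N) (Fin N) ℂ).det ≠ 0 := fun g => by
    rw [Matrix.SpecialLinearGroup.det_coe]
    exact one_ne_zero
  refine ⟨δ₁, (mem_sl3InvariantsOfDegree_iff _ _).2 ⟨fun d hd => ?_, fun g₁ g₂ g₃ w => ?_⟩, fun A B C hA hB hC t => ?_⟩
  · have h := hdeg _ _ d (MvPolynomial.mem_support_iff.2 hd) (hω₁ d (MvPolynomial.mem_support_iff.2 hd))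
    rw [Finsupp.degree_eq_weight_one] at h
    exact h
  · show evalT (actTensor (g₁ : Matrix (Fin N) (Fin N) ℂ) (g₂ : Matrix (Fin N) (Fin N) ℂ) (g₃ : Matrix (Fin N) (Fin N) ℂ) w) F =
      evalT w F
    rw [hsplit, hχ₁ _ (hSL g₁), hχ₂ _ (hSL g₂), hχ₃ _ (hSL g₃), Matrix.SpecialLinearGroup.det_coe,
      Matrix.SpecialLinearGroup.det_coe, Matrix.SpecialLinearGroup.det_coe, one_pow, one_pow, one_pow, one_mul, one_mul,
      one_mul]
  · rw [hsplit, hχ₁ _ hA, hχ₂ _ hB, hχ₃ _ hC, h21, h31, mul_pow, mul_pow]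
    ring

/-- **The equation of a `GL_N³`-stable irreducible hypersurface is an `SL_N³`-invariant form** with character `det^δ ⊗ det^δ ⊗ det^δ`.
[cite: BurgisserIkenmeyer2017, §5, Lemma 5.1] [cite: Grosshans1997, §11] -/
theorem exists_mem_sl3InvariantsOfDegree_of_irreducible_of_stable (hN : 0 < N) {F : MvPolynomial (Idx N) ℂ}
    (hirr : Irreducible F) {S : Tensor ℂ N → Prop} (hZ : ∀ t : Tensor ℂ N, evalT t F = 0 ↔ S t)
    (hS : ∀ (A B C : Matrix (Fin N) (Fin N) ℂ), A.det ≠ 0 → B.det ≠ 0 → C.det ≠ 0 →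
      ∀ t : Tensor ℂ N, S t → S (actTensor A B C t)) :
    ∃ δ : ℕ, F ∈ sl3InvariantsOfDegree (Fin N) ℂ (N * δ) ∧
      ∀ (A B C : Matrix (Fin N) (Fin N) ℂ), A.det ≠ 0 → B.det ≠ 0 → C.det ≠ 0 →
        ∀ t : Tensor ℂ N, evalT (actTensor A B C t) F = (A.det * B.det * C.det) ^ δ * evalT t F :=
  exists_mem_sl3InvariantsOfDegree_of_semiInvariant hN hirr.ne_zero fun _ _ _ hA hB hC =>
    exists_evalT_actTensor_eq_mul_of_irreducible hirr hZ hS hA hB hC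

/-! ## §4 Universal occurrence from an irreducible equation of `{algBorderRank ≤ r}` -/

/-- **Blindness from an irreducible equation.**  Let `0 < N ≤ r` and let `F` be an irreducible polynomial on `ℂ^N⊗ℂ^N⊗ℂ^N` with
`F(t) = 0 ↔ algBorderRank t ≤ r` (the border-rank locus is the irreducible hypersurface `Z(F)`).  Then `F` is an `SL_N³`-invariant
form of some degree `Nδ`, and if `k_N(δ) ≥ 2` for that `δ`, `UOCC(r,N)` holds: every type occurring for a tensor of format `≤ N`
occurs for `⟨r⟩`. [cite: BurgisserIkenmeyer2017, §5] [cite: BurgisserClausenShokrollahi1997, Thm. 20.3] -/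
theorem uocc_of_irreducible_equation {r : ℕ} (hN : 0 < N) (hNr : N ≤ r) {F : MvPolynomial (Idx N) ℂ} (hirr : Irreducible F)
    (hZ : ∀ t : Tensor ℂ N, evalT t F = 0 ↔ algBorderRank t ≤ r)
    (h2 : ∀ δ : ℕ, F.IsHomogeneous (N * δ) → 2 ≤ kronRect ℂ N δ) :
    ∀ {ι : Type} [Fintype ι], Fintype.card ι ≤ N → ∀ (s : ι → ι → ι → ℂ) (d : ℕ) (lam : Fin 3 → Nat.Partition d),
      isotypicSum₁ (lam 0) (isotypicSum₂ (lam 1) (isotypicSum₃ (lam 2) (kroneckerPow s d))) ≠ 0 →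
      isotypicSum₁ (lam 0) (isotypicSum₂ (lam 1) (isotypicSum₃ (lam 2) (kroneckerPow (unitTensor ℂ r) d))) ≠ 0 := by
  obtain ⟨δ, hF, -⟩ := exists_mem_sl3InvariantsOfDegree_of_irreducible_of_stable hN hirr hZ
    fun A B C _ _ _ t ht => (algBorderRank_actTensor_le A B C t).trans ht
  exact fun {ι} _ hι => uocc_of_hypersurface_equation_of_irreducible hN hNr hF hirr
    (h2 δ ((mem_sl3InvariantsOfDegree_iff _ _).1 hF).1) (fun t h => (hZ t).1 h) hι

/-- **`UOCC(18,7)` from an irreducible equation of `σ₁₈(ℂ⁷⊗ℂ⁷⊗ℂ⁷)`.**  If ONE irreducible polynomial `F` cuts out the border-rank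
locus, `F(t) = 0 ↔ algBorderRank t ≤ 18` — i.e. `σ₁₈(7³) = {algBorderRank ≤ 18}` is an irreducible hypersurface
(`dim = 342 = 343 − 1`) [cite: BurgisserClausenShokrollahi1997, Thm. 20.3, Lemma 20.10] [cite: Lickteig1985] — and the Kronecker
atoms `k_7(6) ≥ 2`, `k_7(7) ≥ 2` hold (computed: 438744, 125250433), then every type occurring for some tensor of format `≤ 7`
occurs for `⟨18⟩`: `u(7) ≤ 18 < 19 = R_gen(7)`.  Homogeneity, the degree `7δ` and the `SL₇³`-invariance of `F` are no longer
hypotheses (§1–§3). [cite: BurgisserIkenmeyer2017, §5] -/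
theorem uocc_eighteen_seven_of_irreducible_equation {F : MvPolynomial (Idx 7) ℂ} (hirr : Irreducible F)
    (hZ : ∀ t : Tensor ℂ 7, evalT t F = 0 ↔ algBorderRank t ≤ 18)
    (h6 : 2 ≤ kronRect ℂ 7 6) (h7 : 2 ≤ kronRect ℂ 7 7) :
    ∀ {ι : Type} [Fintype ι], Fintype.card ι ≤ 7 → ∀ (s : ι → ι → ι → ℂ) (d : ℕ) (lam : Fin 3 → Nat.Partition d),
      isotypicSum₁ (lam 0) (isotypicSum₂ (lam 1) (isotypicSum₃ (lam 2) (kroneckerPow s d))) ≠ 0 →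
      isotypicSum₁ (lam 0) (isotypicSum₂ (lam 1) (isotypicSum₃ (lam 2) (kroneckerPow (unitTensor ℂ 18) d))) ≠ 0 := by
  obtain ⟨δ, hF, -⟩ := exists_mem_sl3InvariantsOfDegree_of_irreducible_of_stable (by norm_num) hirr hZ
    fun A B C _ _ _ t ht => (algBorderRank_actTensor_le A B C t).trans ht
  exact fun {ι} _ hι => uocc_eighteen_seven_of_equation hF hirr (fun t h => (hZ t).1 h) h6 h7 hι

/-- The same with the two atoms replaced by the degree bound `deg F ≥ 50`: then `7δ = deg F ≥ 56`, so `δ ≥ 8` and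
`uocc_eighteen_seven_of_equation_of_eight_le` (gen 40; `k_7(δ) ≥ 2` for `δ ≥ 8` by the rectangle law) applies. -/
theorem uocc_eighteen_seven_of_irreducible_equation_of_le_totalDegree {F : MvPolynomial (Idx 7) ℂ} (hirr : Irreducible F)
    (hZ : ∀ t : Tensor ℂ 7, evalT t F = 0 ↔ algBorderRank t ≤ 18) (hdeg : 50 ≤ F.totalDegree) :
    ∀ {ι : Type} [Fintype ι], Fintype.card ι ≤ 7 → ∀ (s : ι → ι → ι → ℂ) (d : ℕ) (lam : Fin 3 → Nat.Partition d),
      isotypicSum₁ (lam 0) (isotypicSum₂ (lam 1) (isotypicSum₃ (lam 2) (kroneckerPow s d))) ≠ 0 →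
      isotypicSum₁ (lam 0) (isotypicSum₂ (lam 1) (isotypicSum₃ (lam 2) (kroneckerPow (unitTensor ℂ 18) d))) ≠ 0 := by
  obtain ⟨δ, hF, -⟩ := exists_mem_sl3InvariantsOfDegree_of_irreducible_of_stable (by norm_num) hirr hZ
    fun A B C _ _ _ t ht => (algBorderRank_actTensor_le A B C t).trans ht
  have hδ : 8 ≤ δ := by
    have h := (((mem_sl3InvariantsOfDegree_iff _ _).1 hF).1).totalDegree hirr.ne_zero
    omega
  exact fun {ι} _ hι => uocc_eighteen_seven_of_equation_of_eight_le hδ hF hirr (fun t h => (hZ t).1 h) hι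

end Summit.MatrixMultiplication.MatrixMultiplication.Theorems.ObstructionCalculus
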